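import Summits.RiemannHypothesis.RiemannHypothesis.Theorems.JensenLogBandArcSaddleCircle
import Summits.RiemannHypothesis.RiemannHypothesis.Theorems.JensenLogBandArcRadialBridgeFrame
import Summits.RiemannHypothesis.RiemannHypothesis.Theorems.JensenLogBandArcRadialBridgeFree
import Summits.RiemannHypothesis.RiemannHypothesis.Theorems.JensenLogBandArcMainTerm
import HarnessLib

/-!
# The right half-arc transform against its Laplace main term (BAND line, step S5 assembled)

RH ladder column JENSEN, rung J-P(P3) «log band», BAND crux `XiDerivBandRealAllRates` of route
«JensenLogBand», line «band-one-window» (u-arc, top-shell reshape), lead rh-jensen-prover g8 — THE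
WINDOW LEMMA (S5) in regime R2: for any radius `ρ` within `5/ℓ_T` of the saddle radius
`r = ‖u* − c‖` (in particular the band radius `h(n,T)`, by F4),

  `‖U_{n,ρ}(c) − Main(c,u*)‖ ≤ (n!/2π)·‖I(φ₀)‖·(‖ζ(½+u*)‖·W + π·F + |ρ − r|·V)`,

`Main = arcMainTerm n c u* = (n!/2πi)·I(φ₀)·(π/w)^{1/2}·ζ(½+u*)`, where `W` is the Laplace window
bracket (S5-1), `F` the flank bracket (F6c × `ζ ≤ 1+1/δ` and [FL-strip]) of
`LogBandArc.arc_integral_saddleCircle_estimate` (p500565), and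
`V = 2·672·log(T+r+1)·e^{2h+11}·e^{−(σ*−1−δ)(ℓ/2−1)}/r` the radial-bridge density
(`LogBandArc.norm_vertical_integrand_le_free`, eng-2 g6 p500968, through the sector frame
`LogBandArc.norm_xiSqArcU_sub_xiSqArcU_le'`, p501219). Since
`‖Main‖ = (n!/2π)·‖I(φ₀)‖·‖ζ(½+u*)‖·(π/‖w‖)^{1/2}` with `‖w‖ ≤ 29n/40` and `‖ζ(½+u*)‖ ≥ δ/(1+δ)`,
every term is `o(‖Main‖)` in the top shell except the fixed `η`-term of `W` (made `≤ 1/40` by the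
choice `ψ₁ = a₀/160`). RH-FREE. WHAT THIS IS NOT: nothing here bears on zeros of `ζ` off the line or
the truth of RH.
-/

noncomputable section

-- single-problem summit: `Summit.RiemannHypothesis.RiemannHypothesis.…` is the tree convention
set_option linter.dupNamespace false

open Complex Real Set MeasureTheory intervalIntegral

namespace Summit.RiemannHypothesis.RiemannHypothesis.Theorems.JensenPolynomials.LogBandArc

open Literature.NumberTheory.LFunctions

variable {n : ℕ} {x T : ℝ} {ustar : ℂ}

/-- **The window lemma (S5), two-sided, at any radius within `5/ℓ_T` of the saddle radius.** See the
module docstring. [folklore] -/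
theorem norm_xiSqArcU_sub_arcMainTerm_le (hx : |x| ≤ 1 / 2) (hT : 100 ≤ T) (hℓ : 100 ≤ ell T)
    (hn : 100 ≤ n) (hh : 1 / 2 ≤ bandRadius n T) (hhT : bandRadius n T ≤ 7 / 20 * T)
    (hH : bandRadius n T ≤ 20)
    (hustar : ‖ustar - ((x : ℂ) + (T : ℂ) * I + bandRadius n T)‖ ≤ 3 / 5 * bandRadius n T)
    (hS : arcSaddleFn n ((x : ℂ) + (T : ℂ) * I) ustar = 0) {ψ₁ δ : ℝ} (hψ₁ : 0 < ψ₁)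
    (hψ₁s : ψ₁ ≤ 11 / 320)
    (hψ₁r : ‖ustar - ((x : ℂ) + (T : ℂ) * I)‖ * ψ₁ ≤ 1 / 20 * bandRadius n T) (hδ : 0 < δ)
    (hδ1 : δ ≤ 1)
    (hwin : 1 + δ + ‖ustar - ((x : ℂ) + (T : ℂ) * I)‖ * ψ₁ ≤ (1 / 2 + ustar).re)
    {ρ : ℝ} (hρ0 : 0 < ρ) (hρ : |ρ - ‖ustar - ((x : ℂ) + (T : ℂ) * I)‖| ≤ 5 / ell T) :
    let c : ℂ := (x : ℂ) + (T : ℂ) * I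
    let r : ℝ := ‖ustar - c‖
    let φ₀ : ℝ := Complex.arg (ustar - c)
    let w : ℂ := deriv (arcSaddleFn n c) ustar * (ustar - c) ^ 2 / 2
    let η : ℝ := r * ψ₁ / δ * Real.exp (r * ψ₁ / δ)
    let W : ℝ := 4 * (1 + η) * (4 * n) / w.re ^ 2 + η * Real.sqrt (π / w.re) +
      2 / (w.re * ψ₁) * Real.exp (-w.re * ψ₁ ^ 2)
    let F : ℝ := Real.exp (12 * bandRadius n T + 6) * (1 + 1 / δ) *
        Real.exp (-(((n : ℝ) + 1) * (1 - Real.cos ψ₁))) +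
      672 * Real.log (T + r) * Real.exp (2 * bandRadius n T + 1) *
        Real.exp (-(((1 / 2 + ustar).re - (1 + δ)) * (ell T / 2 - 1)))
    let V : ℝ := 2 * (672 * Real.log (T + r + 1) * Real.exp (2 * bandRadius n T + 11) *
        Real.exp (-(((1 / 2 + ustar).re - (1 + δ)) * (ell T / 2 - 1)))) / r
    ‖xiSqArcU n ρ c - arcMainTerm n c ustar‖ ≤
      (n.factorial : ℝ) / (2 * π) *
        (‖arcModelIntegrand n r c φ₀‖ * (‖riemannZeta (1 / 2 + ustar)‖ * W + π * F + |ρ - r| * V)) := by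
  intro c r φ₀ w η W F V
  have hT0 : 0 < T := by linarith
  have hℓ20 : 20 ≤ ell T := by linarith
  have hℓ0 : 0 < ell T := by linarith
  obtain ⟨hre_pos, -, -, -, hr_hi⟩ := arcSaddle_polar_bounds hx hT hℓ20 hn hh hhT hustar hS
  have hw0 : ustar - c ≠ 0 := by
    intro h0
    have h' : (0 : ℝ) < (ustar - c).re := hre_pos
    rw [h0] at h'; simp at h'
  have hr0 : 0 < r := norm_pos_iff.2 hw0
  have hδσ : 1 + δ ≤ (1 / 2 + ustar).re := by
    have : 0 ≤ r * ψ₁ := mul_nonneg hr0.le hψ₁.le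
    linarith
  -- `r ≤ (10/9) h ≤ 0.39 T`, so both radii are `< 2 Im c = 2T`
  have hhℓ : bandRadius n T * ell T = 2 * ((n : ℝ) + 1) := bandRadius_mul_ell hℓ20
  have hr_le : r ≤ 10 / 9 * bandRadius n T := by
    have h1 : (n : ℝ) / ell T ≤ bandRadius n T / 2 := by
      rw [div_le_iff₀ hℓ0]; nlinarith
    have h2 : r ≤ 20 / 9 * ((n : ℝ) / ell T) := hr_hi
    linarith
  have hcim : c.im = T := by simp [c]
  have h5ℓ : 5 / ell T ≤ 1 / 20 := by
    rw [div_le_iff₀ hℓ0]; linarith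
  have hρr := abs_le.1 hρ
  have hr2 : r < 2 * c.im := by rw [hcim]; nlinarith
  have hρ2 : ρ < 2 * c.im := by rw [hcim]; nlinarith
  -- (1) the saddle-circle piece
  have hI : (2 * (π : ℂ) * I) ≠ 0 := by simp [Real.pi_ne_zero, I_ne_zero]
  have hmain_eq : xiSqArcU n r c - arcMainTerm n c ustar =
      (n.factorial : ℂ) / (2 * π * I) *
        ((∫ θ in (-(π / 2))..(π / 2), arcIntegrandU n r c θ) -
          arcModelIntegrand n r c φ₀ * ((π : ℂ) / w) ^ (1 / 2 : ℂ) * riemannZeta (1 / 2 + ustar)) := by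
    rw [arcMainTerm_eq_integrand_form, xiSqArcU]
    simp only [arcCurv]
    ring
  have hcircle := arc_integral_saddleCircle_estimate hx hT hℓ20 hn hh hhT hH hustar hS hψ₁ hψ₁s hψ₁r
    hδ hδ1 hwin
  have hnf : ‖(n.factorial : ℂ) / (2 * π * I)‖ = (n.factorial : ℝ) / (2 * π) := by
    rw [norm_div, Complex.norm_natCast, norm_mul, norm_mul, Complex.norm_ofNat, Complex.norm_real,
      Real.norm_eq_abs, abs_of_pos Real.pi_pos, Complex.norm_I, mul_one]
  have h1 : ‖xiSqArcU n r c - arcMainTerm n c ustar‖ ≤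
      (n.factorial : ℝ) / (2 * π) *
        (‖arcModelIntegrand n r c φ₀‖ * (‖riemannZeta (1 / 2 + ustar)‖ * W + π * F)) := by
    rw [hmain_eq, norm_mul, hnf]
    exact mul_le_mul_of_nonneg_left hcircle (by positivity)
  -- (2) the radial bridge from `ρ` to `r`
  set B₁ : ℝ := 672 * Real.log (T + r + 1) * Real.exp (2 * bandRadius n T + 11) *
    Real.exp (-(((1 / 2 + ustar).re - (1 + δ)) * (ell T / 2 - 1))) *
    (‖arcModelIntegrand n r c φ₀‖ / r) with hB₁
  have hpt : ∀ y ∈ uIcc ρ r,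
      ‖xiSq ((c + (y : ℂ) * I) ^ 2) * sqKernel n c (c + (y : ℂ) * I)‖ +
        ‖xiSq ((c - (y : ℂ) * I) ^ 2) * sqKernel n c (c - (y : ℂ) * I)‖ ≤ 2 * B₁ := by
    intro y hy
    -- `|y − r| ≤ |ρ − r| ≤ 5/ℓ` and `y ≤ r + 1`
    have hy_r : |y - r| ≤ 5 / ell T := by
      rcases le_total ρ r with hle | hle
      · rw [uIcc_of_le hle] at hy
        rw [abs_le]; constructor <;> linarith [hy.1, hy.2]
      · rw [uIcc_of_ge hle] at hy
        rw [abs_le]; constructor <;> linarith [hy.1, hy.2]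
    have hy_le : y ≤ r + 1 := by have := (abs_le.1 hy_r).2; linarith
    have hy_ge : r - 1 ≤ y := by have := (abs_le.1 hy_r).1; linarith
    have hlog : Real.log (T + y) ≤ Real.log (T + r + 1) :=
      Real.log_le_log (by linarith) (by linarith)
    have hlog0 : 0 ≤ Real.log (T + y) := Real.log_nonneg (by linarith)
    have hone : ∀ sgn : ℝ, sgn = 1 ∨ sgn = -1 →
        ‖xiSq ((c + ((sgn * y : ℝ) : ℂ) * I) ^ 2)‖ * ‖sqKernel n c (c + ((sgn * y : ℝ) : ℂ) * I)‖ ≤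
          B₁ := by
      intro sgn hsgn
      have h := norm_vertical_integrand_le_free hx hT hℓ hn hh hhT hH hustar hS hδ hδ1 hδσ hsgn hy_r
      refine h.trans ?_
      rw [hB₁]
      have hK : 0 ≤ Real.exp (2 * bandRadius n T + 11) *
          Real.exp (-(((1 / 2 + ustar).re - (1 + δ)) * (ell T / 2 - 1))) *
          (‖arcModelIntegrand n r c φ₀‖ / r) := by positivity
      have := mul_le_mul_of_nonneg_right (mul_le_mul_of_nonneg_left hlog (by norm_num : (0:ℝ) ≤ 672)) hK
      linarith [this]
    have hplus := hone 1 (Or.inl rfl)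
    have hminus := hone (-1) (Or.inr rfl)
    have e1 : c + (((1 : ℝ) * y : ℝ) : ℂ) * I = c + (y : ℂ) * I := by push_cast; ring
    have e2 : c + (((-1 : ℝ) * y : ℝ) : ℂ) * I = c - (y : ℂ) * I := by push_cast; ring
    rw [e1] at hplus
    rw [e2] at hminus
    rw [norm_mul, norm_mul]
    linarith
  have hbridge := norm_xiSqArcU_sub_xiSqArcU_le' n hρ0 hr0 hρ2 hr2 hpt
  -- assemble
  have hsplit : xiSqArcU n ρ c - arcMainTerm n c ustar =
      (xiSqArcU n ρ c - xiSqArcU n r c) + (xiSqArcU n r c - arcMainTerm n c ustar) := by ring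
  rw [hsplit]
  refine (norm_add_le _ _).trans ?_
  have hV : 2 * B₁ = ‖arcModelIntegrand n r c φ₀‖ * V := by
    rw [hB₁]; simp only [V]; field_simp
  rw [hV] at hbridge
  have htotal : (n.factorial : ℝ) / (2 * π) * (|ρ - r| * (‖arcModelIntegrand n r c φ₀‖ * V)) +
      (n.factorial : ℝ) / (2 * π) *
        (‖arcModelIntegrand n r c φ₀‖ * (‖riemannZeta (1 / 2 + ustar)‖ * W + π * F)) =
      (n.factorial : ℝ) / (2 * π) *
        (‖arcModelIntegrand n r c φ₀‖ * (‖riemannZeta (1 / 2 + ustar)‖ * W + π * F + |ρ - r| * V)) := by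
    ring
  linarith [hbridge, h1, htotal]

/-- **The size of the main term, for comparison**: with `w = S′(u*)(u*−c)²/2`,
`‖Main‖ = (n!/2π)·‖I(φ₀)‖·‖ζ(½+u*)‖·(π/‖w‖)^{1/2}`. [folklore] -/
theorem norm_arcMainTerm_eq_integrand (n : ℕ) (c ustar : ℂ) :
    ‖arcMainTerm n c ustar‖ = (n.factorial : ℝ) / (2 * π) *
      (‖arcModelIntegrand n ‖ustar - c‖ c (Complex.arg (ustar - c))‖ *
        ‖riemannZeta (1 / 2 + ustar)‖ *
        (π / ‖deriv (arcSaddleFn n c) ustar * (ustar - c) ^ 2 / 2‖) ^ (1 / 2 : ℝ)) := by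
  rw [norm_arcMainTerm, arcModelIntegrand_eq_I_mul_arcDensity, circleMap_norm_arg, norm_mul,
    Complex.norm_I, one_mul]
  rfl

/-- **The window lemma (S5), `let`-free form** (same statement as
`norm_xiSqArcU_sub_arcMainTerm_le`, every abbreviation spelled out; cheaper to consume). [folklore] -/
theorem norm_xiSqArcU_sub_arcMainTerm_le' (hx : |x| ≤ 1 / 2) (hT : 100 ≤ T) (hℓ : 100 ≤ ell T)
    (hn : 100 ≤ n) (hh : 1 / 2 ≤ bandRadius n T) (hhT : bandRadius n T ≤ 7 / 20 * T)
    (hH : bandRadius n T ≤ 20)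
    (hustar : ‖ustar - ((x : ℂ) + (T : ℂ) * I + bandRadius n T)‖ ≤ 3 / 5 * bandRadius n T)
    (hS : arcSaddleFn n ((x : ℂ) + (T : ℂ) * I) ustar = 0) {ψ₁ δ : ℝ} (hψ₁ : 0 < ψ₁)
    (hψ₁s : ψ₁ ≤ 11 / 320)
    (hψ₁r : ‖ustar - ((x : ℂ) + (T : ℂ) * I)‖ * ψ₁ ≤ 1 / 20 * bandRadius n T) (hδ : 0 < δ)
    (hδ1 : δ ≤ 1)
    (hwin : 1 + δ + ‖ustar - ((x : ℂ) + (T : ℂ) * I)‖ * ψ₁ ≤ (1 / 2 + ustar).re)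
    {ρ : ℝ} (hρ0 : 0 < ρ) (hρ : |ρ - ‖ustar - ((x : ℂ) + (T : ℂ) * I)‖| ≤ 5 / ell T) :
    ‖xiSqArcU n ρ ((x : ℂ) + (T : ℂ) * I) - arcMainTerm n ((x : ℂ) + (T : ℂ) * I) ustar‖ ≤
      (n.factorial : ℝ) / (2 * π) *
        (‖arcModelIntegrand n ‖ustar - ((x : ℂ) + (T : ℂ) * I)‖ ((x : ℂ) + (T : ℂ) * I)
            (Complex.arg (ustar - ((x : ℂ) + (T : ℂ) * I)))‖ *
          (‖riemannZeta (1 / 2 + ustar)‖ *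
              (4 * (1 + ‖ustar - ((x : ℂ) + (T : ℂ) * I)‖ * ψ₁ / δ *
                    Real.exp (‖ustar - ((x : ℂ) + (T : ℂ) * I)‖ * ψ₁ / δ)) * (4 * n) /
                  (deriv (arcSaddleFn n ((x : ℂ) + (T : ℂ) * I)) ustar *
                      (ustar - ((x : ℂ) + (T : ℂ) * I)) ^ 2 / 2).re ^ 2 +
                ‖ustar - ((x : ℂ) + (T : ℂ) * I)‖ * ψ₁ / δ *
                    Real.exp (‖ustar - ((x : ℂ) + (T : ℂ) * I)‖ * ψ₁ / δ) *
                  Real.sqrt (π / (deriv (arcSaddleFn n ((x : ℂ) + (T : ℂ) * I)) ustar *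
                    (ustar - ((x : ℂ) + (T : ℂ) * I)) ^ 2 / 2).re) +
                2 / ((deriv (arcSaddleFn n ((x : ℂ) + (T : ℂ) * I)) ustar *
                      (ustar - ((x : ℂ) + (T : ℂ) * I)) ^ 2 / 2).re * ψ₁) *
                  Real.exp (-(deriv (arcSaddleFn n ((x : ℂ) + (T : ℂ) * I)) ustar *
                    (ustar - ((x : ℂ) + (T : ℂ) * I)) ^ 2 / 2).re * ψ₁ ^ 2)) +
            π * (Real.exp (12 * bandRadius n T + 6) * (1 + 1 / δ) *
                  Real.exp (-(((n : ℝ) + 1) * (1 - Real.cos ψ₁))) +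
                672 * Real.log (T + ‖ustar - ((x : ℂ) + (T : ℂ) * I)‖) *
                  Real.exp (2 * bandRadius n T + 1) *
                  Real.exp (-(((1 / 2 + ustar).re - (1 + δ)) * (ell T / 2 - 1)))) +
            |ρ - ‖ustar - ((x : ℂ) + (T : ℂ) * I)‖| *
              (2 * (672 * Real.log (T + ‖ustar - ((x : ℂ) + (T : ℂ) * I)‖ + 1) *
                  Real.exp (2 * bandRadius n T + 11) *
                  Real.exp (-(((1 / 2 + ustar).re - (1 + δ)) * (ell T / 2 - 1)))) /
                ‖ustar - ((x : ℂ) + (T : ℂ) * I)‖))) :=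
  norm_xiSqArcU_sub_arcMainTerm_le hx hT hℓ hn hh hhT hH hustar hS hψ₁ hψ₁s hψ₁r hδ hδ1 hwin hρ0 hρ

end Summit.RiemannHypothesis.RiemannHypothesis.Theorems.JensenPolynomials.LogBandArc

end
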